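import Literature.Combinatorics.SimpleGraph.TreeAutomorphismDisplacement   -- ★ `TreeDisplacement.dist_self_apply_eq_two_mul_dist` (Serre *Trees* I.6.4)
import HarnessLib

/-!
# R90 · S6 «Ch. 14.1–14.5 stable trace formula» — WAVE 6 card W6-a: the DISPLACEMENT FORMULA for an automorphism of a tree with a
# fixed vertex, `d(x, φ x) = 2 · d(x, p)` for a nearest fixed vertex `p` (`Theorems/R90S6TreeNearestFixedDist.lean`)

Cell `hodgecm-mathlib`, crux H413 (`stmt-HodgeConjecture-24833`), route of record `HCCMUnconditional`; programme R90-TF, section S6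
(base `R90-C14`), seat R90-C14-p05 (g0); S6 WAVE 7 DEAL (R90-C14-plan (g2), 2026-09-04T23:08:14Z) «p05 → W6-a», card W6-a of the sheet
`R90/R90-C14-plan/g2/S6_wave6_targets.v1.R90-C14-plan-g2.lean` 82d8032ceb473274 :33–:35 (signature token-identical, `.Wave6` dropped; AUDIT BOX
S6#W6 CLEAN ×4, R90-C14-audit1 (g2) 23:00:23Z).  Helper lane `--supports stmt-HodgeConjecture-24833 --as helper`; ONE theorem (no definition, no
instance, no notation, no named fact, no `sorry`); imports = ★ `Literature.Combinatorics.SimpleGraph.TreeAutomorphismDisplacement` + HarnessLib.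

DAG r3 row E1.3.5.2.3 «DISPLACEMENT GEOMETRY on the biregular tree … no displacement lemma for tree automorphisms in Mathlib or tree» —
the tree DOES hold it since 2026-09-01: ★ `Literature.Combinatorics.SimpleGraph.TreeDisplacement.dist_self_apply_eq_two_mul_dist` (Serre,
*Trees* I.6.4 Prop. 24–25, elliptic case; written as a generic organ for the «N6nsGerm ∕ S3-tree» road of the same crux).  This file is the
S6-named socket of that theorem: the registered W6-a statement, proved by citing the ★ Literature theorem (no restatement of its proof).

THE MATHEMATICS [Serre1980Trees, I.6.4 Prop. 24–25]: `G` a tree, `φ : G ≃g G`, `p` a `φ`-fixed vertex NEAREST to `x`; the geodesics `[p, x]`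
and `[p, φ x] = φ[p, x]` leave `p` through distinct neighbours (the neighbour of `p` towards `x` is not fixed, by minimality and convexity of
`Fix φ`), so their concatenation is the geodesic from `x` to `φ x`, of length `2·d(x, p)`.  (The Literature proof inducts on the height above
the fixed subtree, ★ `TreeRetraction.exists_retraction` + ★ `BakerNorine.connected_induce_fixed`.)
HONEST LABEL: generic tree combinatorics for the E1-c (full-Hecke FL count on the `U(3)` Bruhat–Tits tree) assembly E1.3.9 — count-neutral
until consumed; proves no printed statement about unitary groups.  HC_CM is proved only modulo the 7 printed citations (2 remaining named
inputs: hLiu418 = stmt-HodgeConjecture-24832, h413 = stmt-HodgeConjecture-24833) until rung 0 closes.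
-/

set_option autoImplicit false
-- the mandated namespace repeats the single-problem summit's segment (`HodgeConjecture.HodgeConjecture`)
set_option linter.dupNamespace false

open SimpleGraph

namespace Summit.HodgeConjecture.HodgeConjecture.R90.S6

variable {V : Type*} (G : SimpleGraph V)

/-- **W6-a (displacement formula)** [Serre1980Trees, I.6.4 Prop. 24–25]: for an automorphism `φ` of a tree and a fixed vertex `p` of `φ`
NEAREST to `x`, the displacement of `x` is twice its distance to `p`: `d(x, φ x) = 2 · d(x, p)`.  (Road: the geodesics `[p, x]` and
`[p, φ x] = φ[p, x]` leave `p` through distinct neighbours — the neighbour of `p` towards `x` is not fixed by minimality — so their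
concatenation is the geodesic from `x` to `φ x`.)  Proof: ★ `Literature.Combinatorics.SimpleGraph.TreeDisplacement.dist_self_apply_eq_two_mul_dist`
(sheet `S6_wave6_targets.v1` :33–:35 token-for-token). [cite: Serre1980Trees, I.6.4 Prop. 24–25] -/
theorem dist_map_eq_two_mul_of_nearest_fixed (hG : G.IsTree) (φ : G ≃g G) (x p : V) (hp : φ p = p)
    (hmin : ∀ q : V, φ q = q → G.dist x p ≤ G.dist x q) : G.dist x (φ x) = 2 * G.dist x p :=
  Literature.Combinatorics.SimpleGraph.TreeDisplacement.dist_self_apply_eq_two_mul_dist hG φ hp hmin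

end Summit.HodgeConjecture.HodgeConjecture.R90.S6
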